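import Mathlib
import HarnessLib
import HarnessLib.Audit
import Summits.ValiantsHypothesis.ValiantsHypothesis.Theorems.LacunarySymmetroidMatrixDescartesProductPlusOneEulerSharpK

/-!
# ValiantsHypothesis / LacunarySymmetroid — crux `MatrixDescartes` (stmt-ValiantsHypothesis-18050, V1), LINE (A) «product_plus_one»:
# two WLOG lemmas for the floor's Euler numerator: REORDERING the rows and FLIPPING THE SIGN of a row do not change it (up to sign)

For the unfolded `eulerNumerator d a l₀ = Σ_j (Σ_l C(a_{jl}(d_l − d_{l₀})) X^{d_l})·∏_{i≠j} f_i` (✓ `eulerNumerator_eq_general`: `= X·P′ − C(m d_{l₀})·P`,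
`P = ∏_j f_j`):
* `euler_reindex` — `E(a ∘ σ) = E(a)` for every permutation `σ` of the rows;
* `euler_neg_row` — negating one row negates `E`: `E(a with row j₀ ↦ −row j₀) = −E(a)`;
* `card_posRoots_euler_reindex` / `card_posRoots_euler_neg_row` — hence the floor count `Z₊` is unchanged by both operations.
So the floor-currency cells of ✓ `…ZeroChangeFloorCells` / `…ZeroChangeFloorDictionary` (stated with the `(+,−,−)`-type row written as
row `0` in the sign form `(−,+,+)`) apply to a T5 row `(+,−,−)` in any position.

HONEST FRAMING: bookkeeping (helper); closes no stub; `OneChangeFloorK3`, `MatrixDescartes` OPEN; `VP ≠ VNP` is NOT proved.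
No definitions, no named facts, no sorry.
-/

set_option linter.dupNamespace false

namespace Summit.ValiantsHypothesis.ValiantsHypothesis.Theorems.LacunarySymmetroidMatrixDescartes

namespace ZeroChange

open Polynomial Finset

/-- **Reordering the rows does not change the Euler numerator.** -/
theorem euler_reindex {m K : ℕ} (d : Fin K → ℕ) (a : Fin m → Fin K → ℝ) (l₀ : Fin K) (σ : Equiv.Perm (Fin m)) :
    (∑ j, (∑ l, C ((a (σ j)) l * ((d l : ℝ) - d l₀)) * X ^ (d l)) * ∏ i ∈ Finset.univ.erase j, (∑ l, C ((a (σ i)) l) * X ^ (d l))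
        : ℝ[X])
      = ∑ j, (∑ l, C (a j l * ((d l : ℝ) - d l₀)) * X ^ (d l)) * ∏ i ∈ Finset.univ.erase j, (∑ l, C (a i l) * X ^ (d l)) := by
  rw [ProductPlusOne.eulerNumerator_eq_general d (fun j => a (σ j)) l₀, ProductPlusOne.eulerNumerator_eq_general d a l₀]
  have hP : (∏ j, ∑ l, C (a (σ j) l) * X ^ (d l) : ℝ[X]) = ∏ j, ∑ l, C (a j l) * X ^ (d l) :=
    Equiv.prod_comp σ (fun j => (∑ l, C (a j l) * X ^ (d l) : ℝ[X]))
  rw [hP]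

/-- **Negating one row negates the Euler numerator.** -/
theorem euler_neg_row {m K : ℕ} (d : Fin K → ℕ) (a : Fin m → Fin K → ℝ) (l₀ : Fin K) (j₀ : Fin m) :
    (∑ j, (∑ l, C ((fun j l => if j = j₀ then -a j l else a j l) j l * ((d l : ℝ) - d l₀)) * X ^ (d l)) *
        ∏ i ∈ Finset.univ.erase j, (∑ l, C ((fun j l => if j = j₀ then -a j l else a j l) i l) * X ^ (d l)) : ℝ[X])
      = -∑ j, (∑ l, C (a j l * ((d l : ℝ) - d l₀)) * X ^ (d l)) * ∏ i ∈ Finset.univ.erase j, (∑ l, C (a i l) * X ^ (d l)) := by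
  classical
  rw [ProductPlusOne.eulerNumerator_eq_general d (fun j l => if j = j₀ then -a j l else a j l) l₀,
    ProductPlusOne.eulerNumerator_eq_general d a l₀]
  have hrow : ∀ j, (∑ l, C ((fun j l => if j = j₀ then -a j l else a j l) j l) * X ^ (d l) : ℝ[X])
      = (if j = j₀ then -1 else 1) * ∑ l, C (a j l) * X ^ (d l) := by
    intro j
    by_cases hj : j = j₀
    · simp only [hj, if_true]
      rw [neg_one_mul, ← Finset.sum_neg_distrib]
      exact Finset.sum_congr rfl fun l _ => by rw [C_neg, neg_mul]
    · simp only [hj, if_false, one_mul]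
  have hP : (∏ j, ∑ l, C ((fun j l => if j = j₀ then -a j l else a j l) j l) * X ^ (d l) : ℝ[X])
      = -∏ j, ∑ l, C (a j l) * X ^ (d l) := by
    rw [Finset.prod_congr rfl (fun j _ => hrow j), Finset.prod_mul_distrib, Finset.prod_ite_eq' univ j₀,
      if_pos (mem_univ _)]
    ring
  rw [hP, derivative_neg]
  ring

/-- Hence the floor count is invariant under reordering the rows … -/
theorem card_posRoots_euler_reindex {m K : ℕ} (d : Fin K → ℕ) (a : Fin m → Fin K → ℝ) (l₀ : Fin K)
    (σ : Equiv.Perm (Fin m)) :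
    ((∑ j, (∑ l, C ((a (σ j)) l * ((d l : ℝ) - d l₀)) * X ^ (d l)) * ∏ i ∈ Finset.univ.erase j, (∑ l, C ((a (σ i)) l) * X ^ (d l))
        : ℝ[X]).roots.toFinset.filter (fun t => 0 < t)).card
      = ((∑ j, (∑ l, C (a j l * ((d l : ℝ) - d l₀)) * X ^ (d l)) * ∏ i ∈ Finset.univ.erase j, (∑ l, C (a i l) * X ^ (d l))
        : ℝ[X]).roots.toFinset.filter (fun t => 0 < t)).card := by
  rw [euler_reindex]

/-- … and under flipping the sign of one row. -/
theorem card_posRoots_euler_neg_row {m K : ℕ} (d : Fin K → ℕ) (a : Fin m → Fin K → ℝ) (l₀ : Fin K) (j₀ : Fin m) :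
    ((∑ j, (∑ l, C ((fun j l => if j = j₀ then -a j l else a j l) j l * ((d l : ℝ) - d l₀)) * X ^ (d l)) *
        ∏ i ∈ Finset.univ.erase j, (∑ l, C ((fun j l => if j = j₀ then -a j l else a j l) i l) * X ^ (d l))
          : ℝ[X]).roots.toFinset.filter (fun t => 0 < t)).card
      = ((∑ j, (∑ l, C (a j l * ((d l : ℝ) - d l₀)) * X ^ (d l)) * ∏ i ∈ Finset.univ.erase j, (∑ l, C (a i l) * X ^ (d l))
        : ℝ[X]).roots.toFinset.filter (fun t => 0 < t)).card := by
  rw [euler_neg_row, roots_neg]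

end ZeroChange

end Summit.ValiantsHypothesis.ValiantsHypothesis.Theorems.LacunarySymmetroidMatrixDescartes
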